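/-
Copyright (c) 2026 the pub-hodgecm-mathlib formalisation cell (harness21).  Prover seat hodgecm-mathlib-K2E4-p03 (g2), Track B «K2-LIT» ∕ h413
(`stmt-HodgeConjecture-24833`), line `K2_E3_EllipticInputs`, unit U3, line U3-d: FILE C rung C1 — the TRANSVECTION class, DYADIC RESIDUAL part (a): the count at
PRINCIPAL LEVEL 2, valid at every residue characteristic.  2026-09-04.
-/
import Summits.HodgeConjecture.HodgeConjecture.Theorems.K2E3TransvectionCentralizerLevel   -- ★ p855634 (this seat): `exists_subgroup_heisBall`, `coe_heis_mul/inv`, `v_eq_one_of_norm_eq_one`, `mem_map_mulLeft_iff`, `map_mulLeft_skew_eq_inf`, `diagonal_one_one_one`, `torus_mul_heis_apply`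
import Literature.NumberTheory.Automorphic.UnitaryThreeRegularUnipotentOrbitFrameDyadic   -- ★ `valued_v_two_le_one`
import HarnessLib

/-!
# K2_E3 road (h413), U3-d FILE C, rung C1 «TRANSVECTION CLASS» — DYADIC RESIDUAL (a): the level `Z(n(τ)) ∩ K(2)` at PRINCIPAL LEVEL 2 in coordinates and the count
# `[C₂ : d(t) C₂ d(t)⁻¹] = [𝒪 : t𝒪]·[𝒪⁻ : t²𝒪⁻]` WITHOUT `v 2 = 1` (Rogawski 1990 §3.9; Harish-Chandra 1999 Lemma 3.2)

Cell `pub/hodgecm-mathlib` (D-0151), Track B; U3-d acting assembly lead K2E3-p21 (g2) («part 2 = ‹C1 dyadic residual› → ‹SC-explicit›», 23:57:52Z); dealer K2E3-plan (g1).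
★ p855657 `K2E3TransvectionCentralizerIndex.relIndex_map_conj_torus_level` counts `[C : dCd⁻¹]` for the HYPERSPECIAL level `C = Z_U(n(τ)) ∩ GL₃(𝒪)` under `v 2 = 1`: the
coordinates `(x, w = z + xσx∕2)` of the unipotent part need `2 ∈ 𝒪ˣ`.  THIS FILE replaces the hyperspecial level by the PRINCIPAL LEVEL-2 box
`C₂ = {g ∈ Z_U(n(τ)) : v((g − 1)ᵢⱼ) ≤ v 2, v((g⁻¹ − 1)ᵢⱼ) ≤ v 2}` (`= C` when `v 2 = 1`): on it `x ∈ 2𝒪` and `v(xσx∕2) = v(x)²∕v 2 ≤ v 2`, so the same coordinates are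
integral at EVERY residue characteristic and the same dévissage (torus removal ★ `relIndex_eq_relIndex_of_coe_subset_mul`; Heisenberg chain `B(v2, v2) ⊇ B(v2·vt, v2) ⊇
B(v2·vt, v2·vt²) = dC₂d⁻¹ ∩ B(v2, v2)` through `g ↦ g₀₁ ∈ 2𝒪` and `g ↦ g₀₂ mod 2t²𝒪`) gives `[C₂ : dC₂d⁻¹] = [2𝒪 : 2t𝒪]·[2𝒪⁻ : 2t²𝒪⁻] = [𝒪 : t𝒪]·[𝒪⁻ : t²𝒪⁻]`
(★ `AddSubgroup.relIndex_map_map_of_injective` along `y ↦ 2y`), for ANY `2 ≠ 0`.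
* §1 `mem_levelTwo_iff` — `C₂` in coordinates `g = diag(α, β, α)·u(x, z)`, `v(α−1), v(β−1), v x, v z ≤ v 2`; `mem_heisBall_two_iff` — `B(v2, v2)` = the unipotent elements of `C₂`.
* the COUNT itself (`relIndex_map_conj_torus_levelTwo`, `= Q²` in the letters `hF1 ∕ hF⁻`) is the sequel `K2E3TransvectionCentralizerLevelTwoIndex` (≤ 400 lines each).
THEOREMS ONLY; lane `--supports stmt-HodgeConjecture-24833 --as helper`.  HONEST LABEL: HC_CM is proved only modulo the 7 printed citations (2 remaining named inputs:
hLiu418 = stmt-HodgeConjecture-24832, h413 = stmt-HodgeConjecture-24833) until rung 0 closes; count-neutral helper.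

## References
* [Rogawski1990] J. D. Rogawski, *Automorphic Representations of Unitary Groups in Three Variables*, Ann. of Math. Stud. 123 (1990), §3.9 p. 32; §8.1 Prop. 8.1.2 (b) p. 114.
* [HarishChandra1999AdmissibleDistributions] Harish-Chandra, *Admissible Invariant Distributions on Reductive p-adic Groups*, ULS 16 (1999), §3.1 Lemma 3.2.
* [Rao1972] R. Ranga Rao, *Orbital integrals in reductive groups*, Ann. of Math. 96 (1972), Theorem.
* [Serre1979] J.-P. Serre, *Local Fields*, GTM 67 (1979), Ch. II §3.
-/

set_option autoImplicit false
-- the mandated namespace repeats the single-problem summit's segment (`HodgeConjecture.HodgeConjecture`), as in every `Theorems/*.lean` of this sub-problem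
set_option linter.dupNamespace false

noncomputable section

open Matrix
open scoped Matrix MatrixGroups Valued WithZero Pointwise
open Literature.NumberTheory.Automorphic Literature.NumberTheory.Automorphic.UnitaryGroup Literature.NumberTheory.Automorphic.HermitianLattice
open Literature.NumberTheory.Automorphic.UnitaryLatticeTree
open Summit.HodgeConjecture.HodgeConjecture.Cruxes.H413.K2E3TransvectionCentralizerLevel

namespace Summit.HodgeConjecture.HodgeConjecture.Cruxes.H413.K2E3TransvectionCentralizerLevelTwo

variable {K : Type*} [Field K] (σ : K →+* K) [Valued K ℤᵐ⁰]

/-! ## §0 Entry bookkeeping -/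

omit [Valued K ℤᵐ⁰] in
/-- `diag(α, β, α)·u(x, z)` written out. [cite: Rogawski1990, §1.10 p. 9] -/
theorem diagonal_mul_heis (α β x z : K) :
    (Matrix.diagonal ![α, β, α] * !![1, x, z; 0, 1, -σ x; 0, 0, 1] : Matrix (Fin 3) (Fin 3) K) = !![α, α * x, α * z; 0, β, -(β * σ x); 0, 0, α] := by
  ext i j; fin_cases i <;> fin_cases j <;> simp [Matrix.mul_apply, Matrix.diagonal]

omit [Valued K ℤᵐ⁰] in
/-- `u(a, b; c)·diag(p, q, r)` written out. [cite: Rogawski1990, §1.10 p. 9] -/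
theorem upperUnipotent_mul_diagonal (a b c p q r : K) :
    (!![1, a, b; 0, 1, c; 0, 0, 1] * Matrix.diagonal ![p, q, r] : Matrix (Fin 3) (Fin 3) K) = !![p, a * q, b * r; 0, q, c * r; 0, 0, r] := by
  ext i j; fin_cases i <;> fin_cases j <;> simp [Matrix.mul_apply, Matrix.diagonal]

/-- Entrywise level bound for an upper triangular matrix: `v((M − 1)ᵢⱼ) ≤ R` from the six visible entries. [folklore] -/
theorem forall_v_sub_one_apply_le {p a b q c r : K} {R : ℤᵐ⁰} (hp : Valued.v (p - 1) ≤ R) (ha : Valued.v a ≤ R) (hb : Valued.v b ≤ R)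
    (hq : Valued.v (q - 1) ≤ R) (hc : Valued.v c ≤ R) (hr : Valued.v (r - 1) ≤ R) :
    ∀ i j : Fin 3, Valued.v (((!![p, a, b; 0, q, c; 0, 0, r] : Matrix (Fin 3) (Fin 3) K) - 1) i j) ≤ R := by
  intro i j
  fin_cases i <;> fin_cases j <;> simp <;> assumption

/-- The visible entries of an upper triangular matrix from the level bound `v((M − 1)ᵢⱼ) ≤ R`. [folklore] -/
theorem v_le_of_forall_v_sub_one_apply_le {p a b q c r : K} {R : ℤᵐ⁰}
    (h : ∀ i j : Fin 3, Valued.v (((!![p, a, b; 0, q, c; 0, 0, r] : Matrix (Fin 3) (Fin 3) K) - 1) i j) ≤ R) :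
    Valued.v (p - 1) ≤ R ∧ Valued.v a ≤ R ∧ Valued.v b ≤ R ∧ Valued.v (q - 1) ≤ R := by
  have h00 := h 0 0; have h01 := h 0 1; have h02 := h 0 2; have h11 := h 1 1
  simp at h00 h01 h02 h11
  exact ⟨h00, h01, h02, h11⟩

/-- `v(a⁻¹ − 1) = v(a − 1)` for `v a = 1`. [cite: Serre1979, Ch. II §3] -/
theorem v_inv_sub_one {a : K} (ha : Valued.v a = 1) : Valued.v (a⁻¹ - 1) = Valued.v (a - 1) := by
  have ha0 : a ≠ 0 := (Valuation.ne_zero_iff _).1 (by rw [ha]; exact one_ne_zero)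
  rw [show a⁻¹ - 1 = a⁻¹ * -(a - 1) by field_simp; ring, Valuation.map_mul, Valuation.map_neg, map_inv₀, ha, inv_one, one_mul]

/-! ## §1 The level-2 centraliser `C₂ = Z_U(n(τ)) ∩ K(2)` in coordinates -/

/-- **`C₂` IN COORDINATES** (`u = n(τ)`, `τ ≠ 0`, `σ` an isometric involution): `g ∈ U(σ, J₀)` commutes with `n(τ)` and `g − 1`, `g⁻¹ − 1` have all entries of valuation
`≤ v 2` iff `g = diag(α, β, α)·u(x, z)` with `σα·α = σβ·β = 1`, `v(α − 1) ≤ v 2`, `v(β − 1) ≤ v 2`, `z + σz + xσx = 0`, `v x ≤ v 2`, `v z ≤ v 2` ([Rogawski1990] §3.9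
«`G_u = S·N`», ★ `exists_coe_eq_torus_mul_upperUnipotent_of_commute`; `v α = v β = 1`). [cite: Rogawski1990, §3.9 p. 32] [cite: Rao1972, Theorem] -/
theorem mem_levelTwo_iff (hσ : ∀ a : K, σ (σ a) = a) (hσv : ∀ a : K, Valued.v (σ a) = Valued.v a) {τ : K} (hτ : τ ≠ 0) {u : GL (Fin 3) K}
    (hu : (u : Matrix (Fin 3) (Fin 3) K) = !![1, 0, τ; 0, 1, 0; 0, 0, 1]) (g : GL (Fin 3) K) :
    (g ∈ unitaryGroupOfForm σ ((StdForm.antidiagonal 3).over K) ∧ g * u = u * g ∧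
        (∀ i j : Fin 3, Valued.v (((g : Matrix (Fin 3) (Fin 3) K) - 1) i j) ≤ Valued.v (2 : K)) ∧
        (∀ i j : Fin 3, Valued.v ((((g⁻¹ : GL (Fin 3) K) : Matrix (Fin 3) (Fin 3) K) - 1) i j) ≤ Valued.v (2 : K))) ↔
      ∃ α β x z : K, σ α * α = 1 ∧ σ β * β = 1 ∧ Valued.v (α - 1) ≤ Valued.v (2 : K) ∧ Valued.v (β - 1) ≤ Valued.v (2 : K) ∧
        z + σ z + x * σ x = 0 ∧ Valued.v x ≤ Valued.v (2 : K) ∧ Valued.v z ≤ Valued.v (2 : K) ∧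
        (g : Matrix (Fin 3) (Fin 3) K) = Matrix.diagonal ![α, β, α] * !![1, x, z; 0, 1, -σ x; 0, 0, 1] := by
  constructor
  · rintro ⟨hgU, hcomm, hint, -⟩
    obtain ⟨α, β, x, z, hα, hβ, hrel, hg⟩ := exists_coe_eq_torus_mul_upperUnipotent_of_commute σ hσ hτ hu hgU hcomm
    have hvα : Valued.v α = 1 := v_eq_one_of_norm_eq_one σ hσv hα
    rw [hg, diagonal_mul_heis] at hint
    obtain ⟨h00, h01, h02, h11⟩ := v_le_of_forall_v_sub_one_apply_le hint
    rw [Valuation.map_mul, hvα, one_mul] at h01 h02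
    exact ⟨α, β, x, z, hα, hβ, h00, h11, hrel, h01, h02, hg⟩
  · rintro ⟨α, β, x, z, hα, hβ, hvα1, hvβ1, hrel, hvx, hvz, hg⟩
    have hα0 : α ≠ 0 := right_ne_zero_of_mul_eq_one hα
    have hβ0 : β ≠ 0 := right_ne_zero_of_mul_eq_one hβ
    have hvα : Valued.v α = 1 := v_eq_one_of_norm_eq_one σ hσv hα
    have hvβ : Valued.v β = 1 := v_eq_one_of_norm_eq_one σ hσv hβ
    obtain ⟨m, hm, hm'⟩ := exists_units_coe_eq_torusS (K := K) hα0 hβ0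
    obtain ⟨n, hn, -⟩ := exists_units_coe_eq_upperTriangularUnipotent x z (-σ x)
    have hgmn : g = m * n := Units.ext (by rw [Units.val_mul, hm, hn, hg])
    have hmU : m ∈ unitaryGroupOfForm σ ((StdForm.antidiagonal 3).over K) :=
      (diagonal_mem_unitaryGroupOfForm_three_iff σ hm).2 ⟨hα, hβ, hα⟩
    have hnU : n ∈ unitaryGroupOfForm σ ((StdForm.antidiagonal 3).over K) :=
      (mem_unitaryGroupOfForm_iff_of_coe_eq_upperUnipotent σ hσ hn).2 ⟨rfl, hrel⟩
    have h2le : Valued.v (2 : K) ≤ 1 := valued_v_two_le_one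
    have hvσx : Valued.v (σ x) ≤ Valued.v (2 : K) := by rw [hσv]; exact hvx
    have hvxx : Valued.v (x * σ x) ≤ Valued.v (2 : K) := by
      rw [Valuation.map_mul, hσv]; exact (mul_le_mul' hvx (hvx.trans h2le)).trans_eq (mul_one _)
    refine ⟨hgmn ▸ mul_mem hmU hnU, ?_, ?_, ?_⟩
    · refine Units.ext ?_
      rw [Units.val_mul, Units.val_mul, hg, hu]
      exact torus_mul_upperUnipotent_commute_cornerUnipotent α β x z (-σ x) τ
    · rw [hg, diagonal_mul_heis]
      refine forall_v_sub_one_apply_le hvα1 ?_ ?_ hvβ1 ?_ hvα1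
      · rw [Valuation.map_mul, hvα, one_mul]; exact hvx
      · rw [Valuation.map_mul, hvα, one_mul]; exact hvz
      · rw [Valuation.map_neg, Valuation.map_mul, hvβ, one_mul]; exact hvσx
    · rw [hgmn, _root_.mul_inv_rev, Units.val_mul, coe_heis_inv σ hn, hm', upperUnipotent_mul_diagonal]
      refine forall_v_sub_one_apply_le ?_ ?_ ?_ ?_ ?_ ?_
      · rw [v_inv_sub_one hvα]; exact hvα1
      · rw [Valuation.map_mul, Valuation.map_neg, map_inv₀, hvβ, inv_one, mul_one]; exact hvx
      · rw [Valuation.map_mul, map_inv₀, hvα, inv_one, mul_one]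
        exact (Valuation.map_sub _ _ _).trans (max_le (by rw [Valuation.map_neg]; exact hvxx) hvz)
      · rw [v_inv_sub_one hvβ]; exact hvβ1
      · rw [map_neg, neg_neg, Valuation.map_mul, hσv, map_inv₀, hvα, inv_one, mul_one]; exact hvx
      · rw [v_inv_sub_one hvα]; exact hvα1

/-- **`B(v2, v2)` = THE UNIPOTENT ELEMENTS OF `C₂`**: `g ∈ C₂` with `g₀₀ = g₁₁ = 1` iff `g = u(x, z)` with `x, z ∈ 2𝒪` (and the unitary relation). [cite: Rogawski1990, §3.9 p. 32] -/
theorem mem_heisBall_two_iff (hσ : ∀ a : K, σ (σ a) = a) (hσv : ∀ a : K, Valued.v (σ a) = Valued.v a) {τ : K} (hτ : τ ≠ 0) {u : GL (Fin 3) K}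
    (hu : (u : Matrix (Fin 3) (Fin 3) K) = !![1, 0, τ; 0, 1, 0; 0, 0, 1])
    {C : Subgroup (GL (Fin 3) K)} (hC : ∀ g : GL (Fin 3) K, g ∈ C ↔ g ∈ unitaryGroupOfForm σ ((StdForm.antidiagonal 3).over K) ∧ g * u = u * g ∧
      (∀ i j : Fin 3, Valued.v (((g : Matrix (Fin 3) (Fin 3) K) - 1) i j) ≤ Valued.v (2 : K)) ∧
      (∀ i j : Fin 3, Valued.v ((((g⁻¹ : GL (Fin 3) K) : Matrix (Fin 3) (Fin 3) K) - 1) i j) ≤ Valued.v (2 : K)))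
    {B : Subgroup (GL (Fin 3) K)} (hB : ∀ g : GL (Fin 3) K, g ∈ B ↔
      ∃ x z : K, z + σ z + x * σ x = 0 ∧ Valued.v x ≤ Valued.v (2 : K) ∧ Valued.v z ≤ Valued.v (2 : K) ∧ (g : Matrix (Fin 3) (Fin 3) K) = !![1, x, z; 0, 1, -σ x; 0, 0, 1])
    (g : GL (Fin 3) K) :
    g ∈ B ↔ g ∈ C ∧ (g : Matrix (Fin 3) (Fin 3) K) 0 0 = 1 ∧ (g : Matrix (Fin 3) (Fin 3) K) 1 1 = 1 := by
  rw [hB, hC, mem_levelTwo_iff σ hσ hσv hτ hu]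
  constructor
  · rintro ⟨x, z, hrel, hvx, hvz, hg⟩
    refine ⟨⟨1, 1, x, z, by rw [map_one, one_mul], by rw [map_one, one_mul], by rw [sub_self, map_zero]; exact zero_le,
      by rw [sub_self, map_zero]; exact zero_le, hrel, hvx, hvz, by rw [diagonal_one_one_one, Matrix.one_mul, hg]⟩, ?_, ?_⟩ <;>
      simp [hg]
  · rintro ⟨⟨α, β, x, z, -, -, -, -, hrel, hvx, hvz, hg⟩, h00, h11⟩
    obtain ⟨e00, e11, -, -⟩ := torus_mul_heis_apply σ α β x z
    rw [hg, e00] at h00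
    rw [hg, e11] at h11
    refine ⟨x, z, hrel, hvx, hvz, ?_⟩
    rw [hg, h00, h11, diagonal_one_one_one, Matrix.one_mul]

end Summit.HodgeConjecture.HodgeConjecture.Cruxes.H413.K2E3TransvectionCentralizerLevelTwo

end
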